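import Summits.FinalStateConjecture.FinalStateConjecture.Theorems.PhaseMixingCaptureNearExtremalKappaCaptureUnitTemperatureFaceFrameGeometry

/-!
# Unit-temperature front face, part 3: smoothness down to `σ = 0`, face values, horizon identities

Support file for the stub `stub_unitTemperatureFace` (S1) of the line `unit-temperature-front-face`
(crux `NearExtremalKappaCapture`, route `PhaseMixingCapture`). The closed forms of part 2 are
`M²`-multiples of rational functions of `(σ, x̂, cos θ)` and `√(1 − σ²)` with the denominator
`D = (1 + σ + 2σx̂)² + (1 − σ²)cos²θ ≥ 1` on the box `[0, ½] × [−½, X] × ℝ`, hence jointly `C^∞`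
there INCLUDING the extremal face `σ = 0` (`smoothαβ`); at `σ = 0` they are the near-NHEK metric at
unit temperature in ingoing co-rotating form (`faceαβ`); and on every face the horizon `x̂ = 0` has
`G₀₀ = 0`, `G₀₁ = 2Σ₊`, `∂_x̂G₀₀ = −2G₀₁` (`horizon00`, `horizon01`, `horizonDeriv`). Pure calculus;
no named fact is used.
-/

noncomputable section

-- the doubled `FinalStateConjecture.FinalStateConjecture` path component trips dupNamespace
set_option linter.dupNamespace false

namespace Summit.FinalStateConjecture.FinalStateConjecture.Theorems.NearExtremalKappaCapture.UnitTemperatureFrontFace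

open Literature.Geometry.Lorentzian
open Set
open scoped ContDiff

/-- Joint smoothness of the closed form `G00` on the box `[0, ½] × [−½, X] × ℝ` (the
denominator `D` is positive there and `1 − σ² ≠ 0`). -/
theorem smooth00 (M X : ℝ) :
    ContDiffOn ℝ ∞ (fun q : ℝ × ℝ × ℝ ↦
      M ^ (2 : ℕ) * (-4 * q.2.1 * (1 + q.1) * (Real.cos q.2.2 ^ (4 : ℕ) * q.1 ^ (3 : ℕ) * q.2.1
      + Real.cos q.2.2 ^ (4 : ℕ) * q.1 ^ (3 : ℕ) - Real.cos q.2.2 ^ (4 : ℕ) * q.1 ^ (2 : ℕ) *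
      q.2.1 - Real.cos q.2.2 ^ (4 : ℕ) * q.1 ^ (2 : ℕ) - Real.cos q.2.2 ^ (4 : ℕ) * q.1 * q.2.1
      - Real.cos q.2.2 ^ (4 : ℕ) * q.1 + Real.cos q.2.2 ^ (4 : ℕ) * q.2.1 + Real.cos q.2.2 ^ (4
      : ℕ) - 4 * Real.cos q.2.2 ^ (2 : ℕ) * q.1 ^ (3 : ℕ) * q.2.1 ^ (3 : ℕ) - 8 * Real.cos q.2.2
      ^ (2 : ℕ) * q.1 ^ (3 : ℕ) * q.2.1 ^ (2 : ℕ) - 6 * Real.cos q.2.2 ^ (2 : ℕ) * q.1 ^ (3 : ℕ)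
      * q.2.1 - 2 * Real.cos q.2.2 ^ (2 : ℕ) * q.1 ^ (3 : ℕ) + 4 * Real.cos q.2.2 ^ (2 : ℕ) *
      q.1 ^ (2 : ℕ) * q.2.1 ^ (3 : ℕ) - 6 * Real.cos q.2.2 ^ (2 : ℕ) * q.1 ^ (2 : ℕ) * q.2.1 - 2
      * Real.cos q.2.2 ^ (2 : ℕ) * q.1 ^ (2 : ℕ) + 8 * Real.cos q.2.2 ^ (2 : ℕ) * q.1 * q.2.1 ^
      (2 : ℕ) + 6 * Real.cos q.2.2 ^ (2 : ℕ) * q.1 * q.2.1 + 2 * Real.cos q.2.2 ^ (2 : ℕ) * q.1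
      + 6 * Real.cos q.2.2 ^ (2 : ℕ) * q.2.1 + 2 * Real.cos q.2.2 ^ (2 : ℕ) + 4 * q.1 ^ (3 : ℕ)
      * q.2.1 ^ (3 : ℕ) + 8 * q.1 ^ (3 : ℕ) * q.2.1 ^ (2 : ℕ) + 5 * q.1 ^ (3 : ℕ) * q.2.1 + q.1
      ^ (3 : ℕ) - 4 * q.1 ^ (2 : ℕ) * q.2.1 ^ (3 : ℕ) + 7 * q.1 ^ (2 : ℕ) * q.2.1 + 3 * q.1 ^ (2
      : ℕ) - 8 * q.1 * q.2.1 ^ (2 : ℕ) - q.1 * q.2.1 + 3 * q.1 - 3 * q.2.1 + 1) / ((1 + q.1 + 2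
      * q.1 * q.2.1) ^ (2 : ℕ) + (1 - q.1 ^ (2 : ℕ)) * Real.cos q.2.2 ^ (2 : ℕ))))
      (Icc (0 : ℝ) (1 / 2) ×ˢ Icc (-(1 / 2) : ℝ) X ×ˢ (univ : Set ℝ)) := by
  intro q hq
  simp only [mem_prod, mem_Icc, mem_univ] at hq
  obtain ⟨⟨hs0, hs1⟩, ⟨hx, -⟩, -⟩ := hq
  have hs2 : q.1 ^ 2 ≤ 1 := by nlinarith
  have hD : (1 + q.1 + 2 * q.1 * q.2.1) ^ 2 + (1 - q.1 ^ 2) * Real.cos q.2.2 ^ 2 ≠ 0 :=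
    (denom_param_pos hs0 hs2 hx _).ne'
  have h1 : 1 - q.1 ^ 2 ≠ 0 := by nlinarith
  apply ContDiffAt.contDiffWithinAt
  fun_prop (disch := assumption)

/-- Joint smoothness of the closed form `G01` on the box `[0, ½] × [−½, X] × ℝ` (the
denominator `D` is positive there and `1 − σ² ≠ 0`). -/
theorem smooth01 (M X : ℝ) :
    ContDiffOn ℝ ∞ (fun q : ℝ × ℝ × ℝ ↦
      M ^ (2 : ℕ) * (2 * (4 * (1 + q.1) * (1 + q.1 + 2 * q.1 * q.2.1) - (1 - q.1 ^ (2 : ℕ)) * (1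
      - Real.cos q.2.2 ^ (2 : ℕ)) * (((1 + q.1 + 2 * q.1 * q.2.1) ^ (2 : ℕ) + (1 - q.1 ^ (2 :
      ℕ)) * Real.cos q.2.2 ^ (2 : ℕ)) + 2 * (1 + q.1 + 2 * q.1 * q.2.1))) / ((1 + q.1 + 2 * q.1
      * q.2.1) ^ (2 : ℕ) + (1 - q.1 ^ (2 : ℕ)) * Real.cos q.2.2 ^ (2 : ℕ))))
      (Icc (0 : ℝ) (1 / 2) ×ˢ Icc (-(1 / 2) : ℝ) X ×ˢ (univ : Set ℝ)) := by
  intro q hq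
  simp only [mem_prod, mem_Icc, mem_univ] at hq
  obtain ⟨⟨hs0, hs1⟩, ⟨hx, -⟩, -⟩ := hq
  have hs2 : q.1 ^ 2 ≤ 1 := by nlinarith
  have hD : (1 + q.1 + 2 * q.1 * q.2.1) ^ 2 + (1 - q.1 ^ 2) * Real.cos q.2.2 ^ 2 ≠ 0 :=
    (denom_param_pos hs0 hs2 hx _).ne'
  have h1 : 1 - q.1 ^ 2 ≠ 0 := by nlinarith
  apply ContDiffAt.contDiffWithinAt
  fun_prop (disch := assumption)

/-- Joint smoothness of the closed form `G03` on the box `[0, ½] × [−½, X] × ℝ` (the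
denominator `D` is positive there and `1 − σ² ≠ 0`). -/
theorem smooth03 (M X : ℝ) :
    ContDiffOn ℝ ∞ (fun q : ℝ × ℝ × ℝ ↦
      M ^ (2 : ℕ) * (4 * q.2.1 * √(1 - q.1 ^ (2 : ℕ)) * (1 - Real.cos q.2.2 ^ (2 : ℕ)) *
      (-(Real.cos q.2.2 ^ (2 : ℕ) * q.1 ^ (3 : ℕ) * q.2.1) - Real.cos q.2.2 ^ (2 : ℕ) * q.1 ^ (3
      : ℕ) + Real.cos q.2.2 ^ (2 : ℕ) * q.1 * q.2.1 + Real.cos q.2.2 ^ (2 : ℕ) * q.1 + 4 * q.1 ^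
      (3 : ℕ) * q.2.1 ^ (3 : ℕ) + 8 * q.1 ^ (3 : ℕ) * q.2.1 ^ (2 : ℕ) + 5 * q.1 ^ (3 : ℕ) *
      q.2.1 + q.1 ^ (3 : ℕ) + 8 * q.1 ^ (2 : ℕ) * q.2.1 ^ (2 : ℕ) + 12 * q.1 ^ (2 : ℕ) * q.2.1 +
      4 * q.1 ^ (2 : ℕ) + 7 * q.1 * q.2.1 + 5 * q.1 + 2) / ((1 + q.1 + 2 * q.1 * q.2.1) ^ (2 :
      ℕ) + (1 - q.1 ^ (2 : ℕ)) * Real.cos q.2.2 ^ (2 : ℕ))))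
      (Icc (0 : ℝ) (1 / 2) ×ˢ Icc (-(1 / 2) : ℝ) X ×ˢ (univ : Set ℝ)) := by
  intro q hq
  simp only [mem_prod, mem_Icc, mem_univ] at hq
  obtain ⟨⟨hs0, hs1⟩, ⟨hx, -⟩, -⟩ := hq
  have hs2 : q.1 ^ 2 ≤ 1 := by nlinarith
  have hD : (1 + q.1 + 2 * q.1 * q.2.1) ^ 2 + (1 - q.1 ^ 2) * Real.cos q.2.2 ^ 2 ≠ 0 :=
    (denom_param_pos hs0 hs2 hx _).ne'
  have h1 : 1 - q.1 ^ 2 ≠ 0 := by nlinarith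
  apply ContDiffAt.contDiffWithinAt
  fun_prop (disch := assumption)

/-- Joint smoothness of the closed form `G11` on the box `[0, ½] × [−½, X] × ℝ` (the
denominator `D` is positive there and `1 − σ² ≠ 0`). -/
theorem smooth11 (M X : ℝ) :
    ContDiffOn ℝ ∞ (fun q : ℝ × ℝ × ℝ ↦
      M ^ (2 : ℕ) * (4 * q.1 ^ (2 : ℕ) * (((1 + q.1 + 2 * q.1 * q.2.1) ^ (2 : ℕ) + (1 - q.1 ^ (2
      : ℕ)) * Real.cos q.2.2 ^ (2 : ℕ)) + 2 * (1 + q.1 + 2 * q.1 * q.2.1)) / ((1 + q.1 + 2 * q.1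
      * q.2.1) ^ (2 : ℕ) + (1 - q.1 ^ (2 : ℕ)) * Real.cos q.2.2 ^ (2 : ℕ))))
      (Icc (0 : ℝ) (1 / 2) ×ˢ Icc (-(1 / 2) : ℝ) X ×ˢ (univ : Set ℝ)) := by
  intro q hq
  simp only [mem_prod, mem_Icc, mem_univ] at hq
  obtain ⟨⟨hs0, hs1⟩, ⟨hx, -⟩, -⟩ := hq
  have hs2 : q.1 ^ 2 ≤ 1 := by nlinarith
  have hD : (1 + q.1 + 2 * q.1 * q.2.1) ^ 2 + (1 - q.1 ^ 2) * Real.cos q.2.2 ^ 2 ≠ 0 :=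
    (denom_param_pos hs0 hs2 hx _).ne'
  have h1 : 1 - q.1 ^ 2 ≠ 0 := by nlinarith
  apply ContDiffAt.contDiffWithinAt
  fun_prop (disch := assumption)

/-- Joint smoothness of the closed form `G13` on the box `[0, ½] × [−½, X] × ℝ` (the
denominator `D` is positive there and `1 − σ² ≠ 0`). -/
theorem smooth13 (M X : ℝ) :
    ContDiffOn ℝ ∞ (fun q : ℝ × ℝ × ℝ ↦
      M ^ (2 : ℕ) * (-2 * q.1 * √(1 - q.1 ^ (2 : ℕ)) * (1 - Real.cos q.2.2 ^ (2 : ℕ)) * (((1 +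
      q.1 + 2 * q.1 * q.2.1) ^ (2 : ℕ) + (1 - q.1 ^ (2 : ℕ)) * Real.cos q.2.2 ^ (2 : ℕ)) + 2 *
      (1 + q.1 + 2 * q.1 * q.2.1)) / ((1 + q.1 + 2 * q.1 * q.2.1) ^ (2 : ℕ) + (1 - q.1 ^ (2 :
      ℕ)) * Real.cos q.2.2 ^ (2 : ℕ))))
      (Icc (0 : ℝ) (1 / 2) ×ˢ Icc (-(1 / 2) : ℝ) X ×ˢ (univ : Set ℝ)) := by
  intro q hq
  simp only [mem_prod, mem_Icc, mem_univ] at hq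
  obtain ⟨⟨hs0, hs1⟩, ⟨hx, -⟩, -⟩ := hq
  have hs2 : q.1 ^ 2 ≤ 1 := by nlinarith
  have hD : (1 + q.1 + 2 * q.1 * q.2.1) ^ 2 + (1 - q.1 ^ 2) * Real.cos q.2.2 ^ 2 ≠ 0 :=
    (denom_param_pos hs0 hs2 hx _).ne'
  have h1 : 1 - q.1 ^ 2 ≠ 0 := by nlinarith
  apply ContDiffAt.contDiffWithinAt
  fun_prop (disch := assumption)

/-- Joint smoothness of the closed form `G22` on the box `[0, ½] × [−½, X] × ℝ` (the
denominator `D` is positive there and `1 − σ² ≠ 0`). -/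
theorem smooth22 (M X : ℝ) :
    ContDiffOn ℝ ∞ (fun q : ℝ × ℝ × ℝ ↦
      M ^ (2 : ℕ) * ((1 + q.1 + 2 * q.1 * q.2.1) ^ (2 : ℕ) + (1 - q.1 ^ (2 : ℕ)) * Real.cos
      q.2.2 ^ (2 : ℕ)))
      (Icc (0 : ℝ) (1 / 2) ×ˢ Icc (-(1 / 2) : ℝ) X ×ˢ (univ : Set ℝ)) := by
  intro q hq
  simp only [mem_prod, mem_Icc, mem_univ] at hq
  obtain ⟨⟨hs0, hs1⟩, ⟨hx, -⟩, -⟩ := hq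
  have hs2 : q.1 ^ 2 ≤ 1 := by nlinarith
  have hD : (1 + q.1 + 2 * q.1 * q.2.1) ^ 2 + (1 - q.1 ^ 2) * Real.cos q.2.2 ^ 2 ≠ 0 :=
    (denom_param_pos hs0 hs2 hx _).ne'
  have h1 : 1 - q.1 ^ 2 ≠ 0 := by nlinarith
  apply ContDiffAt.contDiffWithinAt
  fun_prop (disch := assumption)

/-- Joint smoothness of the closed form `G33` on the box `[0, ½] × [−½, X] × ℝ` (the
denominator `D` is positive there and `1 − σ² ≠ 0`). -/
theorem smooth33 (M X : ℝ) :
    ContDiffOn ℝ ∞ (fun q : ℝ × ℝ × ℝ ↦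
      M ^ (2 : ℕ) * ((1 - Real.cos q.2.2 ^ (2 : ℕ)) * (((1 + q.1 + 2 * q.1 * q.2.1) ^ (2 : ℕ) +
      (1 - q.1 ^ (2 : ℕ))) * ((1 + q.1 + 2 * q.1 * q.2.1) ^ (2 : ℕ) + (1 - q.1 ^ (2 : ℕ)) *
      Real.cos q.2.2 ^ (2 : ℕ)) + 2 * (1 + q.1 + 2 * q.1 * q.2.1) * (1 - q.1 ^ (2 : ℕ)) * (1 -
      Real.cos q.2.2 ^ (2 : ℕ))) / ((1 + q.1 + 2 * q.1 * q.2.1) ^ (2 : ℕ) + (1 - q.1 ^ (2 : ℕ))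
      * Real.cos q.2.2 ^ (2 : ℕ))))
      (Icc (0 : ℝ) (1 / 2) ×ˢ Icc (-(1 / 2) : ℝ) X ×ˢ (univ : Set ℝ)) := by
  intro q hq
  simp only [mem_prod, mem_Icc, mem_univ] at hq
  obtain ⟨⟨hs0, hs1⟩, ⟨hx, -⟩, -⟩ := hq
  have hs2 : q.1 ^ 2 ≤ 1 := by nlinarith
  have hD : (1 + q.1 + 2 * q.1 * q.2.1) ^ 2 + (1 - q.1 ^ 2) * Real.cos q.2.2 ^ 2 ≠ 0 :=
    (denom_param_pos hs0 hs2 hx _).ne'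
  have h1 : 1 - q.1 ^ 2 ≠ 0 := by nlinarith
  apply ContDiffAt.contDiffWithinAt
  fun_prop (disch := assumption)

/-- The front-face value (`σ = 0`) of the closed form `G00` (near-NHEK at unit temperature). -/
theorem face00 (M x c : ℝ) :
    M ^ (2 : ℕ) * (-4 * x * (1 + 0) * (c ^ (4 : ℕ) * 0 ^ (3 : ℕ) * x + c ^ (4 : ℕ) * 0 ^ (3 :
      ℕ) - c ^ (4 : ℕ) * 0 ^ (2 : ℕ) * x - c ^ (4 : ℕ) * 0 ^ (2 : ℕ) - c ^ (4 : ℕ) * 0 * x - c ^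
      (4 : ℕ) * 0 + c ^ (4 : ℕ) * x + c ^ (4 : ℕ) - 4 * c ^ (2 : ℕ) * 0 ^ (3 : ℕ) * x ^ (3 : ℕ)
      - 8 * c ^ (2 : ℕ) * 0 ^ (3 : ℕ) * x ^ (2 : ℕ) - 6 * c ^ (2 : ℕ) * 0 ^ (3 : ℕ) * x - 2 * c
      ^ (2 : ℕ) * 0 ^ (3 : ℕ) + 4 * c ^ (2 : ℕ) * 0 ^ (2 : ℕ) * x ^ (3 : ℕ) - 6 * c ^ (2 : ℕ) *
      0 ^ (2 : ℕ) * x - 2 * c ^ (2 : ℕ) * 0 ^ (2 : ℕ) + 8 * c ^ (2 : ℕ) * 0 * x ^ (2 : ℕ) + 6 *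
      c ^ (2 : ℕ) * 0 * x + 2 * c ^ (2 : ℕ) * 0 + 6 * c ^ (2 : ℕ) * x + 2 * c ^ (2 : ℕ) + 4 * 0
      ^ (3 : ℕ) * x ^ (3 : ℕ) + 8 * 0 ^ (3 : ℕ) * x ^ (2 : ℕ) + 5 * 0 ^ (3 : ℕ) * x + 0 ^ (3 :
      ℕ) - 4 * 0 ^ (2 : ℕ) * x ^ (3 : ℕ) + 7 * 0 ^ (2 : ℕ) * x + 3 * 0 ^ (2 : ℕ) - 8 * 0 * x ^
      (2 : ℕ) - 0 * x + 3 * 0 - 3 * x + 1) / ((1 + 0 + 2 * 0 * x) ^ (2 : ℕ) + (1 - 0 ^ (2 : ℕ))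
      * c ^ (2 : ℕ))) =
      -4 * M ^ 2 * (1 + c ^ 2) * x * (1 + x) + 16 * M ^ 2 * (1 - c ^ 2) * x ^ 2 / (1 + c ^ 2) := by
  have hc : (1 + c ^ 2) ≠ 0 := by positivity
  have hD : (1 + 0 + 2 * 0 * x) ^ 2 + (1 - 0 ^ 2) * c ^ 2 = 1 + c ^ 2 := by ring
  rw [hD]
  field_simp
  ring
/-- The front-face value (`σ = 0`) of the closed form `G01` (near-NHEK at unit temperature). -/
theorem face01 (M x c : ℝ) :
    M ^ (2 : ℕ) * (2 * (4 * (1 + 0) * (1 + 0 + 2 * 0 * x) - (1 - 0 ^ (2 : ℕ)) * (1 - c ^ (2 :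
      ℕ)) * (((1 + 0 + 2 * 0 * x) ^ (2 : ℕ) + (1 - 0 ^ (2 : ℕ)) * c ^ (2 : ℕ)) + 2 * (1 + 0 + 2
      * 0 * x))) / ((1 + 0 + 2 * 0 * x) ^ (2 : ℕ) + (1 - 0 ^ (2 : ℕ)) * c ^ (2 : ℕ))) =
      2 * M ^ 2 * (1 + c ^ 2) := by
  have hc : (1 + c ^ 2) ≠ 0 := by positivity
  have hD : (1 + 0 + 2 * 0 * x) ^ 2 + (1 - 0 ^ 2) * c ^ 2 = 1 + c ^ 2 := by ring
  rw [hD]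
  field_simp
  ring
/-- The front-face value (`σ = 0`) of the closed form `G03` (near-NHEK at unit temperature). -/
theorem face03 (M x c : ℝ) :
    M ^ (2 : ℕ) * (4 * x * √(1 - 0 ^ (2 : ℕ)) * (1 - c ^ (2 : ℕ)) * (-(c ^ (2 : ℕ) * 0 ^ (3 :
      ℕ) * x) - c ^ (2 : ℕ) * 0 ^ (3 : ℕ) + c ^ (2 : ℕ) * 0 * x + c ^ (2 : ℕ) * 0 + 4 * 0 ^ (3 :
      ℕ) * x ^ (3 : ℕ) + 8 * 0 ^ (3 : ℕ) * x ^ (2 : ℕ) + 5 * 0 ^ (3 : ℕ) * x + 0 ^ (3 : ℕ) + 8 *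
      0 ^ (2 : ℕ) * x ^ (2 : ℕ) + 12 * 0 ^ (2 : ℕ) * x + 4 * 0 ^ (2 : ℕ) + 7 * 0 * x + 5 * 0 +
      2) / ((1 + 0 + 2 * 0 * x) ^ (2 : ℕ) + (1 - 0 ^ (2 : ℕ)) * c ^ (2 : ℕ))) =
      8 * M ^ 2 * (1 - c ^ 2) * x / (1 + c ^ 2) := by
  have hc : (1 + c ^ 2) ≠ 0 := by positivity
  have hD : (1 + 0 + 2 * 0 * x) ^ 2 + (1 - 0 ^ 2) * c ^ 2 = 1 + c ^ 2 := by ring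
  rw [hD, show (1 : ℝ) - 0 ^ 2 = 1 by norm_num, Real.sqrt_one]
  field_simp
  ring
/-- The front-face value (`σ = 0`) of the closed form `G11` (near-NHEK at unit temperature). -/
theorem face11 (M x c : ℝ) :
    M ^ (2 : ℕ) * (4 * 0 ^ (2 : ℕ) * (((1 + 0 + 2 * 0 * x) ^ (2 : ℕ) + (1 - 0 ^ (2 : ℕ)) * c ^
      (2 : ℕ)) + 2 * (1 + 0 + 2 * 0 * x)) / ((1 + 0 + 2 * 0 * x) ^ (2 : ℕ) + (1 - 0 ^ (2 : ℕ)) *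
      c ^ (2 : ℕ))) =
      0 := by
  ring
/-- The front-face value (`σ = 0`) of the closed form `G13` (near-NHEK at unit temperature). -/
theorem face13 (M x c : ℝ) :
    M ^ (2 : ℕ) * (-2 * 0 * √(1 - 0 ^ (2 : ℕ)) * (1 - c ^ (2 : ℕ)) * (((1 + 0 + 2 * 0 * x) ^
      (2 : ℕ) + (1 - 0 ^ (2 : ℕ)) * c ^ (2 : ℕ)) + 2 * (1 + 0 + 2 * 0 * x)) / ((1 + 0 + 2 * 0 *
      x) ^ (2 : ℕ) + (1 - 0 ^ (2 : ℕ)) * c ^ (2 : ℕ))) =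
      0 := by
  ring
/-- The front-face value (`σ = 0`) of the closed form `G22` (near-NHEK at unit temperature). -/
theorem face22 (M x c : ℝ) :
    M ^ (2 : ℕ) * ((1 + 0 + 2 * 0 * x) ^ (2 : ℕ) + (1 - 0 ^ (2 : ℕ)) * c ^ (2 : ℕ)) =
      M ^ 2 * (1 + c ^ 2) := by
  ring
/-- The front-face value (`σ = 0`) of the closed form `G33` (near-NHEK at unit temperature). -/
theorem face33 (M x c : ℝ) :
    M ^ (2 : ℕ) * ((1 - c ^ (2 : ℕ)) * (((1 + 0 + 2 * 0 * x) ^ (2 : ℕ) + (1 - 0 ^ (2 : ℕ))) *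
      ((1 + 0 + 2 * 0 * x) ^ (2 : ℕ) + (1 - 0 ^ (2 : ℕ)) * c ^ (2 : ℕ)) + 2 * (1 + 0 + 2 * 0 *
      x) * (1 - 0 ^ (2 : ℕ)) * (1 - c ^ (2 : ℕ))) / ((1 + 0 + 2 * 0 * x) ^ (2 : ℕ) + (1 - 0 ^ (2
      : ℕ)) * c ^ (2 : ℕ))) =
      4 * M ^ 2 * (1 - c ^ 2) / (1 + c ^ 2) := by
  have hc : (1 + c ^ 2) ≠ 0 := by positivity
  have hD : (1 + 0 + 2 * 0 * x) ^ 2 + (1 - 0 ^ 2) * c ^ 2 = 1 + c ^ 2 := by ring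
  rw [hD]
  field_simp
  ring
/-- On every face `σ ∈ [0, ½]` the closed form `G₀₀` vanishes on the horizon `x̂ = 0` (`K` is null on `𝓗⁺`). -/
theorem horizon00 (M s c : ℝ) :
    M ^ (2 : ℕ) * (-4 * 0 * (1 + s) * (c ^ (4 : ℕ) * s ^ (3 : ℕ) * 0 + c ^ (4 : ℕ) * s ^ (3 :
      ℕ) - c ^ (4 : ℕ) * s ^ (2 : ℕ) * 0 - c ^ (4 : ℕ) * s ^ (2 : ℕ) - c ^ (4 : ℕ) * s * 0 - c ^
      (4 : ℕ) * s + c ^ (4 : ℕ) * 0 + c ^ (4 : ℕ) - 4 * c ^ (2 : ℕ) * s ^ (3 : ℕ) * 0 ^ (3 : ℕ)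
      - 8 * c ^ (2 : ℕ) * s ^ (3 : ℕ) * 0 ^ (2 : ℕ) - 6 * c ^ (2 : ℕ) * s ^ (3 : ℕ) * 0 - 2 * c
      ^ (2 : ℕ) * s ^ (3 : ℕ) + 4 * c ^ (2 : ℕ) * s ^ (2 : ℕ) * 0 ^ (3 : ℕ) - 6 * c ^ (2 : ℕ) *
      s ^ (2 : ℕ) * 0 - 2 * c ^ (2 : ℕ) * s ^ (2 : ℕ) + 8 * c ^ (2 : ℕ) * s * 0 ^ (2 : ℕ) + 6 *
      c ^ (2 : ℕ) * s * 0 + 2 * c ^ (2 : ℕ) * s + 6 * c ^ (2 : ℕ) * 0 + 2 * c ^ (2 : ℕ) + 4 * s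
      ^ (3 : ℕ) * 0 ^ (3 : ℕ) + 8 * s ^ (3 : ℕ) * 0 ^ (2 : ℕ) + 5 * s ^ (3 : ℕ) * 0 + s ^ (3 :
      ℕ) - 4 * s ^ (2 : ℕ) * 0 ^ (3 : ℕ) + 7 * s ^ (2 : ℕ) * 0 + 3 * s ^ (2 : ℕ) - 8 * s * 0 ^
      (2 : ℕ) - s * 0 + 3 * s - 3 * 0 + 1) / ((1 + s + 2 * s * 0) ^ (2 : ℕ) + (1 - s ^ (2 : ℕ))
      * c ^ (2 : ℕ))) = 0 := by
  ring

/-- On every face `σ ∈ [0, ½]`: `G₀₁(σ, 0, θ) = 2Σ₊ = 2(r₊² + a²cos²θ)`, `a = M√(1 − σ²)`, `r₊ = M(1 + σ)`. -/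
theorem horizon01 {M s : ℝ} (hM : 0 < M) (hs : s ∈ Icc (0 : ℝ) (1 / 2)) (c : ℝ) :
    M ^ (2 : ℕ) * (2 * (4 * (1 + s) * (1 + s + 2 * s * 0) - (1 - s ^ (2 : ℕ)) * (1 - c ^ (2 :
      ℕ)) * (((1 + s + 2 * s * 0) ^ (2 : ℕ) + (1 - s ^ (2 : ℕ)) * c ^ (2 : ℕ)) + 2 * (1 + s + 2
      * s * 0))) / ((1 + s + 2 * s * 0) ^ (2 : ℕ) + (1 - s ^ (2 : ℕ)) * c ^ (2 : ℕ))) =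
      2 * (Kerr.rPlus M (M * √(1 - s ^ 2)) ^ 2 + (M * √(1 - s ^ 2)) ^ 2 * c ^ 2) := by
  obtain ⟨hs0, hs1⟩ := hs
  have hs2 : s ^ 2 ≤ 1 := by nlinarith
  rw [rPlus_param hM.le hs0 hs2 rfl, sq_param hs2 (rfl : M * √(1 - s ^ 2) = M * √(1 - s ^ 2))]
  have hD : (1 + s + 2 * s * 0) ^ 2 + (1 - s ^ 2) * c ^ 2 ≠ 0 :=
    (denom_param_pos hs0 hs2 (by norm_num) c).ne'
  set Dv := (1 + s + 2 * s * 0) ^ 2 + (1 - s ^ 2) * c ^ 2 with hDv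
  field_simp
  rw [hDv]
  ring

/-- On every face `σ ∈ [0, ½]` the horizon `x̂ = 0` has unit surface gravity in the blown-up frame:
`∂_x̂ G₀₀(σ, 0, θ) = −2 G₀₁(σ, 0, θ)` (`G₀₀ = x̂ · g` with `g` smooth, so the derivative at `0` is `g(0)`). -/
theorem horizonDeriv {M s : ℝ} (hM : 0 < M) (hs : s ∈ Icc (0 : ℝ) (1 / 2)) (c : ℝ) :
    deriv (fun y : ℝ ↦
      M ^ (2 : ℕ) * (-4 * y * (1 + s) * (c ^ (4 : ℕ) * s ^ (3 : ℕ) * y + c ^ (4 : ℕ) * s ^ (3 :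
      ℕ) - c ^ (4 : ℕ) * s ^ (2 : ℕ) * y - c ^ (4 : ℕ) * s ^ (2 : ℕ) - c ^ (4 : ℕ) * s * y - c ^
      (4 : ℕ) * s + c ^ (4 : ℕ) * y + c ^ (4 : ℕ) - 4 * c ^ (2 : ℕ) * s ^ (3 : ℕ) * y ^ (3 : ℕ)
      - 8 * c ^ (2 : ℕ) * s ^ (3 : ℕ) * y ^ (2 : ℕ) - 6 * c ^ (2 : ℕ) * s ^ (3 : ℕ) * y - 2 * c
      ^ (2 : ℕ) * s ^ (3 : ℕ) + 4 * c ^ (2 : ℕ) * s ^ (2 : ℕ) * y ^ (3 : ℕ) - 6 * c ^ (2 : ℕ) *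
      s ^ (2 : ℕ) * y - 2 * c ^ (2 : ℕ) * s ^ (2 : ℕ) + 8 * c ^ (2 : ℕ) * s * y ^ (2 : ℕ) + 6 *
      c ^ (2 : ℕ) * s * y + 2 * c ^ (2 : ℕ) * s + 6 * c ^ (2 : ℕ) * y + 2 * c ^ (2 : ℕ) + 4 * s
      ^ (3 : ℕ) * y ^ (3 : ℕ) + 8 * s ^ (3 : ℕ) * y ^ (2 : ℕ) + 5 * s ^ (3 : ℕ) * y + s ^ (3 :
      ℕ) - 4 * s ^ (2 : ℕ) * y ^ (3 : ℕ) + 7 * s ^ (2 : ℕ) * y + 3 * s ^ (2 : ℕ) - 8 * s * y ^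
      (2 : ℕ) - s * y + 3 * s - 3 * y + 1) / ((1 + s + 2 * s * y) ^ (2 : ℕ) + (1 - s ^ (2 : ℕ))
      * c ^ (2 : ℕ)))) 0 =
      -2 * (M ^ (2 : ℕ) * (2 * (4 * (1 + s) * (1 + s + 2 * s * 0) - (1 - s ^ (2 : ℕ)) * (1 - c ^ (2 :
      ℕ)) * (((1 + s + 2 * s * 0) ^ (2 : ℕ) + (1 - s ^ (2 : ℕ)) * c ^ (2 : ℕ)) + 2 * (1 + s + 2
      * s * 0))) / ((1 + s + 2 * s * 0) ^ (2 : ℕ) + (1 - s ^ (2 : ℕ)) * c ^ (2 : ℕ)))) := by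
  obtain ⟨hs0, hs1⟩ := hs
  have hs2 : s ^ 2 ≤ 1 := by nlinarith
  have hD : (1 + s + 2 * s * 0) ^ 2 + (1 - s ^ 2) * c ^ 2 ≠ 0 :=
    (denom_param_pos hs0 hs2 (by norm_num) c).ne'
  have hfun : (fun y : ℝ ↦
      M ^ (2 : ℕ) * (-4 * y * (1 + s) * (c ^ (4 : ℕ) * s ^ (3 : ℕ) * y + c ^ (4 : ℕ) * s ^ (3 :
      ℕ) - c ^ (4 : ℕ) * s ^ (2 : ℕ) * y - c ^ (4 : ℕ) * s ^ (2 : ℕ) - c ^ (4 : ℕ) * s * y - c ^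
      (4 : ℕ) * s + c ^ (4 : ℕ) * y + c ^ (4 : ℕ) - 4 * c ^ (2 : ℕ) * s ^ (3 : ℕ) * y ^ (3 : ℕ)
      - 8 * c ^ (2 : ℕ) * s ^ (3 : ℕ) * y ^ (2 : ℕ) - 6 * c ^ (2 : ℕ) * s ^ (3 : ℕ) * y - 2 * c
      ^ (2 : ℕ) * s ^ (3 : ℕ) + 4 * c ^ (2 : ℕ) * s ^ (2 : ℕ) * y ^ (3 : ℕ) - 6 * c ^ (2 : ℕ) *
      s ^ (2 : ℕ) * y - 2 * c ^ (2 : ℕ) * s ^ (2 : ℕ) + 8 * c ^ (2 : ℕ) * s * y ^ (2 : ℕ) + 6 *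
      c ^ (2 : ℕ) * s * y + 2 * c ^ (2 : ℕ) * s + 6 * c ^ (2 : ℕ) * y + 2 * c ^ (2 : ℕ) + 4 * s
      ^ (3 : ℕ) * y ^ (3 : ℕ) + 8 * s ^ (3 : ℕ) * y ^ (2 : ℕ) + 5 * s ^ (3 : ℕ) * y + s ^ (3 :
      ℕ) - 4 * s ^ (2 : ℕ) * y ^ (3 : ℕ) + 7 * s ^ (2 : ℕ) * y + 3 * s ^ (2 : ℕ) - 8 * s * y ^
      (2 : ℕ) - s * y + 3 * s - 3 * y + 1) / ((1 + s + 2 * s * y) ^ (2 : ℕ) + (1 - s ^ (2 : ℕ))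
      * c ^ (2 : ℕ)))) = fun y : ℝ ↦ y *
        (M ^ (2 : ℕ) * (-4 * (1 + s) * (c ^ (4 : ℕ) * s ^ (3 : ℕ) * y + c ^ (4 : ℕ) * s ^ (3 : ℕ)
        - c ^ (4 : ℕ) * s ^ (2 : ℕ) * y - c ^ (4 : ℕ) * s ^ (2 : ℕ) - c ^ (4 : ℕ) * s * y - c ^
        (4 : ℕ) * s + c ^ (4 : ℕ) * y + c ^ (4 : ℕ) - 4 * c ^ (2 : ℕ) * s ^ (3 : ℕ) * y ^ (3 :
        ℕ) - 8 * c ^ (2 : ℕ) * s ^ (3 : ℕ) * y ^ (2 : ℕ) - 6 * c ^ (2 : ℕ) * s ^ (3 : ℕ) * y - 2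
        * c ^ (2 : ℕ) * s ^ (3 : ℕ) + 4 * c ^ (2 : ℕ) * s ^ (2 : ℕ) * y ^ (3 : ℕ) - 6 * c ^ (2 :
        ℕ) * s ^ (2 : ℕ) * y - 2 * c ^ (2 : ℕ) * s ^ (2 : ℕ) + 8 * c ^ (2 : ℕ) * s * y ^ (2 : ℕ)
        + 6 * c ^ (2 : ℕ) * s * y + 2 * c ^ (2 : ℕ) * s + 6 * c ^ (2 : ℕ) * y + 2 * c ^ (2 : ℕ)
        + 4 * s ^ (3 : ℕ) * y ^ (3 : ℕ) + 8 * s ^ (3 : ℕ) * y ^ (2 : ℕ) + 5 * s ^ (3 : ℕ) * y +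
        s ^ (3 : ℕ) - 4 * s ^ (2 : ℕ) * y ^ (3 : ℕ) + 7 * s ^ (2 : ℕ) * y + 3 * s ^ (2 : ℕ) - 8
        * s * y ^ (2 : ℕ) - s * y + 3 * s - 3 * y + 1) / ((1 + s + 2 * s * y) ^ (2 : ℕ) + (1 - s
        ^ (2 : ℕ)) * c ^ (2 : ℕ)))) := by
    funext y
    ring
  have hg : DifferentiableAt ℝ (fun y : ℝ ↦
        M ^ (2 : ℕ) * (-4 * (1 + s) * (c ^ (4 : ℕ) * s ^ (3 : ℕ) * y + c ^ (4 : ℕ) * s ^ (3 : ℕ)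
        - c ^ (4 : ℕ) * s ^ (2 : ℕ) * y - c ^ (4 : ℕ) * s ^ (2 : ℕ) - c ^ (4 : ℕ) * s * y - c ^
        (4 : ℕ) * s + c ^ (4 : ℕ) * y + c ^ (4 : ℕ) - 4 * c ^ (2 : ℕ) * s ^ (3 : ℕ) * y ^ (3 :
        ℕ) - 8 * c ^ (2 : ℕ) * s ^ (3 : ℕ) * y ^ (2 : ℕ) - 6 * c ^ (2 : ℕ) * s ^ (3 : ℕ) * y - 2
        * c ^ (2 : ℕ) * s ^ (3 : ℕ) + 4 * c ^ (2 : ℕ) * s ^ (2 : ℕ) * y ^ (3 : ℕ) - 6 * c ^ (2 :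
        ℕ) * s ^ (2 : ℕ) * y - 2 * c ^ (2 : ℕ) * s ^ (2 : ℕ) + 8 * c ^ (2 : ℕ) * s * y ^ (2 : ℕ)
        + 6 * c ^ (2 : ℕ) * s * y + 2 * c ^ (2 : ℕ) * s + 6 * c ^ (2 : ℕ) * y + 2 * c ^ (2 : ℕ)
        + 4 * s ^ (3 : ℕ) * y ^ (3 : ℕ) + 8 * s ^ (3 : ℕ) * y ^ (2 : ℕ) + 5 * s ^ (3 : ℕ) * y +
        s ^ (3 : ℕ) - 4 * s ^ (2 : ℕ) * y ^ (3 : ℕ) + 7 * s ^ (2 : ℕ) * y + 3 * s ^ (2 : ℕ) - 8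
        * s * y ^ (2 : ℕ) - s * y + 3 * s - 3 * y + 1) / ((1 + s + 2 * s * y) ^ (2 : ℕ) + (1 - s
        ^ (2 : ℕ)) * c ^ (2 : ℕ)))) 0 := by
    fun_prop (disch := assumption)
  rw [hfun, deriv_fun_mul differentiableAt_fun_id hg]
  simp only [deriv_id'', zero_mul, add_zero, one_mul]
  set Dv := (1 + s + 2 * s * 0) ^ 2 + (1 - s ^ 2) * c ^ 2 with hDv
  field_simp
  rw [hDv]
  ring

end Summit.FinalStateConjecture.FinalStateConjecture.Theorems.NearExtremalKappaCapture.UnitTemperatureFrontFace
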